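import Literature.Probability.LatticeModels.IsingDecoration
import Literature.Probability.LatticeModels.GriffithsMonotonicity
import HarnessLib

/-!
# The one-site heat-bath (DLR) identity with FREE boundary condition
(crux `CoerciveSharpness.PhiCoercive`, item stmt-CriticalPhenomena-18196, line `box-superset`;
helper stub `stub_freeHeatBath`)

For a locally finite graph `G`, a finite volume `Λ ∋ x`, zero field, the free boundary condition
and an observable `g` that does not read the spin at `x`,

`⟨σ_x g⟩^∅_{Λ;β,0} = ⟨tanh(β Σ_{y ∼ x, y ∈ Λ} σ_y) · g⟩^∅_{Λ;β,0}`: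

under the free finite-volume Gibbs measure (Hamiltonian `-Σ_{edges inside Λ} σσ`) the
conditional mean of `σ_x` given the other spins is `tanh(β ×` sum of its neighbours INSIDE `Λ)`
(Friedli–Velenik 2017, Lemma 6.7 / Exercise 3.11 — the spatial Markov property with `Δ = {x}`).

## Proof

The tree has the identity for FIXED boundary conditions with the sum over ALL neighbours
(`isingExpect_spinAt_mul_eq_tanh`, `IsingDecoration.lean`). Let `G₁` be the graph of the edges
of `G` with both endpoints in `Λ` (the construction of `isingCorr_free_mono_volume_of_gks`,
`GriffithsMonotonicity.lean`). Then

* `ℰ_Λ(G₁) = ℰ_Λ(G)`, so the free measures of `Λ` for `G` and `G₁` coincide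
  (`isingMeasure_free_congr_edgesIn`);
* no edge of `G₁` leaves `Λ`, `ℰ_Λ(G₁) = ℰ^b_Λ(G₁)`, so the free and the `+ = fixed 1` measures of
  `Λ` for `G₁` coincide (`isingExpect_free_eq_plus_of_edgesIn_eq`);
* the fixed identity for `G₁`, whose neighbour set of `x ∈ Λ` is `{y ∼ x : y ∈ Λ}`.

The general-graph form is `isingExpect_spinAt_mul_eq_tanh_free`; the registered stub
`stub_freeHeatBath` is its instance `G = ℤ³`.

## References

* S. Friedli, Y. Velenik, *Statistical Mechanics of Lattice Systems* (CUP 2017), §3.1 (free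
  boundary condition, eq. (3.2)), Lemma 6.7 / Exercise 3.11 [FriedliVelenik2017].
-/

noncomputable section

namespace Summit.CriticalPhenomena.Ising3DConformalLimit.Cruxes.PhiCoercive.BoxSuperset

open scoped BigOperators
open Finset
open Literature.Probability.LatticeModels

/-- **The heat-bath (one-site DLR) identity at zero field, free boundary condition, any locally
finite graph.** For `x ∈ Λ` and a measurable observable `g` that does not read the spin at `x`,
`⟨σ_x g⟩^∅_{Λ;β,0} = ⟨tanh(β Σ_{y ∼ x, y ∈ Λ} σ_y) · g⟩^∅_{Λ;β,0}` — only the neighbours of `x`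
inside `Λ` interact with `x` under the free boundary condition. Reduction to the tree's fixed-b.c.
identity `isingExpect_spinAt_mul_eq_tanh` on the graph `G₁` of edges inside `Λ`
(Friedli–Velenik 2017, Lemma 6.7 / Exercise 3.11; §3.1 eq. (3.2)). -/
theorem isingExpect_spinAt_mul_eq_tanh_free {V : Type*} [DecidableEq V] (G : SimpleGraph V)
    [G.LocallyFinite] {Λ : Finset V} {x : V} (hx : x ∈ Λ) (β : ℝ) {g : SpinConfig V → ℝ}
    (hgm : Measurable g) (hg : ∀ (σ : SpinConfig V) (u : ℤˣ), g (Function.update σ x u) = g σ) :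
    isingExpect G Λ β 0 .free (fun σ => spinAt x σ * g σ) =
      isingExpect G Λ β 0 .free
        (fun σ => Real.tanh (β * ∑ y ∈ (G.neighborFinset x).filter (fun y => y ∈ Λ),
          spinAt y σ) * g σ) := by
  -- the graph `G₁`: edges of `G` with both endpoints in `Λ`
  -- (adapted from `isingCorr_free_mono_volume_of_gks`, GriffithsMonotonicity.lean)
  let G₁ : SimpleGraph V :=
    { Adj := fun a b => G.Adj a b ∧ a ∈ Λ ∧ b ∈ Λ
      symm := ⟨fun a b hab => ⟨hab.1.symm, hab.2.2, hab.2.1⟩⟩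
      loopless := ⟨fun a ha => G.irrefl ha.1⟩ }
  haveI : G₁.LocallyFinite := fun v =>
    Fintype.ofFinset ((G.neighborFinset v).filter fun w => v ∈ Λ ∧ w ∈ Λ) fun w => by
      simp [G₁, SimpleGraph.mem_neighborSet]
  -- same edges inside `Λ`
  have hE : edgesIn G₁ Λ = edgesIn G Λ := by
    ext e'
    rw [mem_edgesIn_iff, mem_edgesIn_iff]
    induction e' using Sym2.ind with
    | _ a b =>
      simp only [SimpleGraph.mem_edgeSet, G₁]
      constructor
      · rintro ⟨⟨hab, -, -⟩, hmem⟩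
        exact ⟨hab, hmem⟩
      · rintro ⟨hab, hmem⟩
        exact ⟨⟨hab, hmem a (Sym2.mem_mk_left _ _), hmem b (Sym2.mem_mk_right _ _)⟩, hmem⟩
  -- no edge of `G₁` leaves `Λ`
  have hT : edgesIn G₁ Λ = edgesTouching G₁ Λ := by
    refine Finset.Subset.antisymm (edgesIn_subset_edgesTouching Λ) fun e' he' => ?_
    rw [mem_edgesTouching_iff] at he'
    rw [mem_edgesIn_iff]
    refine ⟨he'.1, ?_⟩
    induction e' using Sym2.ind with
    | _ a b =>
      have hab := (SimpleGraph.mem_edgeSet G₁).1 he'.1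
      intro z hz
      rcases Sym2.mem_iff.1 hz with rfl | rfl
      · exact hab.2.1
      · exact hab.2.2
  -- the neighbours of `x ∈ Λ` in `G₁` are its `G`-neighbours inside `Λ`
  have hN : G₁.neighborFinset x = (G.neighborFinset x).filter (fun y => y ∈ Λ) := by
    ext y
    simp only [SimpleGraph.mem_neighborFinset, Finset.mem_filter, G₁]
    exact ⟨fun h => ⟨h.1, h.2.2⟩, fun h => ⟨h.1, hx, h.2⟩⟩
  -- free for `G₁` = fixed `1` (`= plus`) for `G₁`: same glued configurations (the free outside
  -- is the junk value `1`), same interaction edges (`hT`)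
  -- (adapted from `isingMeasure_free_eq_plus_of_edgesIn_eq`, PlusCurrents.lean)
  have hμ : isingMeasure G₁ Λ β 0 .free = isingMeasure G₁ Λ β 0 (.fixed 1) := by
    have hgl : (fun τ : Λ → ℤˣ => glue Λ τ .free) = fun τ => glue Λ τ (.fixed 1) :=
      funext (glue_free_eq_glue_plus Λ)
    have hH : isingHamiltonian G₁ Λ 0 .free = isingHamiltonian G₁ Λ 0 (.fixed 1) := by
      funext σ
      rw [isingHamiltonian, isingHamiltonian, interactionEdges_free, interactionEdges_fixed, hT]
    unfold isingMeasure isingRef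
    rw [hgl, hH]
  -- free for `G` = free for `G₁` (`ℰ_Λ(G₁) = ℰ_Λ(G)`) = fixed `1` for `G₁`
  have hfp : ∀ f : SpinConfig V → ℝ,
      isingExpect G Λ β 0 .free f = isingExpect G₁ Λ β 0 (.fixed 1) f := by
    intro f
    unfold isingExpect
    rw [← hμ, isingMeasure_free_congr_edgesIn hE]
  rw [hfp, hfp, isingExpect_spinAt_mul_eq_tanh G₁ hx β 1 hgm hg, hN]

/-- **Stub `stub_freeHeatBath` (line `box-superset` of crux `PhiCoercive`): the one-site DLR
identity with free boundary condition on `ℤ³`.** For `x ∈ S`, zero field and a measurable `g` not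
reading `σ_x`, `⟨σ_x g⟩^free_{S;β} = ⟨tanh(β Σ_{y ∼ x, y ∈ S} σ_y) · g⟩^free_{S;β}`
(`isingExpect_spinAt_mul_eq_tanh_free` for `G = ℤ³`; Friedli–Velenik 2017, Lemma 6.7 /
Exercise 3.11). -/
theorem stub_freeHeatBath : ∀ (β : ℝ) (S : Finset (Site 3)) (x : Site 3), x ∈ S →
    ∀ (g : SpinConfig (Site 3) → ℝ), Measurable g →
    (∀ (σ : SpinConfig (Site 3)) (u : ℤˣ), g (Function.update σ x u) = g σ) →
    isingExpect (zdGraph 3) S β 0 .free (fun σ => spinAt x σ * g σ) =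
      isingExpect (zdGraph 3) S β 0 .free
        (fun σ => Real.tanh (β * ∑ y ∈ ((zdGraph 3).neighborFinset x).filter (fun y => y ∈ S),
          spinAt y σ) * g σ) :=
  fun β _ _ hx _ hgm hg => isingExpect_spinAt_mul_eq_tanh_free (zdGraph 3) hx β hgm hg

end Summit.CriticalPhenomena.Ising3DConformalLimit.Cruxes.PhiCoercive.BoxSuperset

end
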